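import Mathlib
import HarnessLib
import Summits.NavierStokesRegularity.NavierStokesRegularity.Theorems.PoloidalWindowDoorLrcModEntirePeriodicSheetAtTime

/-!
# Route `PoloidalWindowDoor`, item `LrcModEntire` (stmt-NavierStokesRegularity-20428), cell (Q4-curved) of the (TH) column —
# B-TWP0c, WINDOW SELECTION FOR THE NON-VERTICAL CHILD: a height window with `d′ ≠ 0`, `d ≠ 0` and `R″ ≠ 0` (class-free)

Cell ns-regularity-ideate, stub-worker seat ns-poloidal-K2-p2 g18 under the LEAD of item 20428 (ns-poloidal-K2-p3 g17/g18);
`--supports stmt-NavierStokesRegularity-20428 --as helper`.  Memo `Cruxes/LrcModEntire/TOWER-CLOSES-port2g9.md` §D1 («such `W` exists iff `d′ ≢ 0`»; the pole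
argument needs heights with `d ≠ 0`, `d′ ≠ 0` and `Q = R″/κ_f ≠ 0`).  For the NON-VERTICAL child of `stub_Q4curvedAperiodic` (v16), whatever binder-currency literal
the LEAD keys, its content is «the parallel offset `d` of `…CurvedWebPackage.curved_web_package` is not identically zero near `0`»; this file turns that into the
rectangle the tower runs on.

* `exists_deriv_ne_zero_near` — `d` differentiable near `0`, `d 0 = 0`, `d z₀ ≠ 0` for some small `z₀` ⇒ `d′(z₁) ≠ 0` at some `z₁` between (mean value theorem);
* ★ `exists_tower_window` — `d ∈ C¹` on `(−δ′, δ′)` with `d 0 = 0` and `d ≢ 0` on every neighbourhood of `0`, `g = R(0,·)` real-analytic on `(−δ, δ)` and not affine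
  on `|z| < δ` (the cell's non-sonic literal), `δ′ ≤ δ` ⊢ for every `0 < ε ≤ δ′` an open interval `Ioo a b ⊆ Ioo (−ε) ε`, `a < b`, on which `deriv d ≠ 0`, `d ≠ 0`
  and `deriv (deriv g) ≠ 0` (`…PeriodicSheetAtTime.exists_noncharacteristic_window` on a sub-window where `d′ ≠ 0`; then `d` is injective there, so it vanishes
  at most once, and one of the two halves avoids that zero).

WHAT THIS IS NOT: not a claim about Navier–Stokes regularity; closes nothing; items 20428 / 19708 / 27893 OPEN (bears_on LADDER-NS N0).
-/

noncomputable section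

set_option linter.dupNamespace false
set_option linter.style.longLine false

namespace Summit.NavierStokesRegularity.NavierStokesRegularity.Theorems.PoloidalWindowDoorLrcModEntireCurvedWebWindowSelect

open Set Function Filter Topology
open Summit.NavierStokesRegularity.NavierStokesRegularity.Theorems.PoloidalWindowDoorLrcModEntirePeriodicSheetAtTime

/-- **Mean value step**: `d` differentiable on `(−δ′, δ′)`, `d 0 = 0`, `d z₀ ≠ 0` with `|z₀| < δ′` ⇒ `deriv d z₁ ≠ 0` for some `|z₁| ≤ |z₀|`. -/
theorem exists_deriv_ne_zero_near {d : ℝ → ℝ} {δ' z₀ : ℝ} (hd : ∀ z ∈ Ioo (-δ') δ', DifferentiableAt ℝ d z) (hd0 : d 0 = 0)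
    (hz₀ : |z₀| < δ') (hne : d z₀ ≠ 0) : ∃ z₁ : ℝ, |z₁| ≤ |z₀| ∧ deriv d z₁ ≠ 0 := by
  have hz₀ne : z₀ ≠ 0 := by rintro rfl; exact hne hd0
  rcases lt_or_gt_of_ne hz₀ne with hneg | hpos
  · -- `z₀ < 0`: MVT on `[z₀, 0]`
    have hsub : Icc z₀ 0 ⊆ Ioo (-δ') δ' := fun z hz =>
      ⟨by linarith [hz.1, (abs_lt.1 hz₀).1], by linarith [hz.2, hz₀, abs_nonneg z₀]⟩
    have hcont : ContinuousOn d (Icc z₀ 0) := fun z hz => (hd z (hsub hz)).continuousAt.continuousWithinAt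
    have hdiff : DifferentiableOn ℝ d (Ioo z₀ 0) := fun z hz => (hd z (hsub (Ioo_subset_Icc_self hz))).differentiableWithinAt
    obtain ⟨c, hc, hcd⟩ := exists_deriv_eq_slope d hneg hcont hdiff
    refine ⟨c, ?_, ?_⟩
    · rw [abs_of_neg hneg, abs_le]; constructor <;> linarith [hc.1, hc.2]
    · rw [hcd, hd0]; intro h
      have : (0 - d z₀) = 0 := by
        have hne0 : (0 : ℝ) - z₀ ≠ 0 := by linarith
        field_simp at h; linarith [h]
      exact hne (by linarith)
  · have hsub : Icc 0 z₀ ⊆ Ioo (-δ') δ' := fun z hz =>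
      ⟨by linarith [hz.1, hz₀, abs_nonneg z₀], by linarith [hz.2, (abs_lt.1 hz₀).2]⟩
    have hcont : ContinuousOn d (Icc 0 z₀) := fun z hz => (hd z (hsub hz)).continuousAt.continuousWithinAt
    have hdiff : DifferentiableOn ℝ d (Ioo 0 z₀) := fun z hz => (hd z (hsub (Ioo_subset_Icc_self hz))).differentiableWithinAt
    obtain ⟨c, hc, hcd⟩ := exists_deriv_eq_slope d hpos hcont hdiff
    refine ⟨c, ?_, ?_⟩
    · rw [abs_of_pos hpos, abs_le]; constructor <;> linarith [hc.1, hc.2]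
    · rw [hcd, hd0]; intro h
      have hne0 : z₀ - 0 ≠ 0 := by linarith
      have : d z₀ - 0 = 0 := by field_simp at h; linarith [h]
      exact hne (by linarith)

/-- ★ **THE TOWER WINDOW OF THE NON-VERTICAL CHILD.**  See the module docstring. -/
theorem exists_tower_window {d g : ℝ → ℝ} {δ δ' : ℝ} (hδ'δ : δ' ≤ δ)
    (hd : ContDiffOn ℝ 1 d (Ioo (-δ') δ')) (hd0 : d 0 = 0) (hnv : ∀ ε : ℝ, 0 < ε → ∃ z : ℝ, |z| < ε ∧ d z ≠ 0)
    (hg : AnalyticOnNhd ℝ g (Ioo (-δ) δ)) (hns : ¬ (∃ a b : ℝ, ∀ z : ℝ, |z| < δ → g z = a + b * z))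
    {ε : ℝ} (hε : 0 < ε) (hεδ' : ε ≤ δ') :
    ∃ a b : ℝ, a < b ∧ Ioo a b ⊆ Ioo (-ε) ε ∧ (∀ z ∈ Ioo a b, deriv d z ≠ 0) ∧ (∀ z ∈ Ioo a b, d z ≠ 0) ∧
      (∀ z ∈ Ioo a b, deriv (deriv g) z ≠ 0) := by
  have hIo : IsOpen (Ioo (-δ') δ') := isOpen_Ioo
  have hdd : ∀ z ∈ Ioo (-δ') δ', DifferentiableAt ℝ d z := fun z hz => (hd.differentiableOn one_ne_zero z hz).differentiableAt (hIo.mem_nhds hz)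
  have hd'c : ContinuousOn (deriv d) (Ioo (-δ') δ') := (hd.continuousOn_deriv_of_isOpen hIo le_rfl)
  -- a point with `d′ ≠ 0` inside `(−ε, ε)`
  obtain ⟨z₀, hz₀, hne⟩ := hnv (ε / 2) (by linarith)
  obtain ⟨z₁, hz₁, hd'z₁⟩ := exists_deriv_ne_zero_near hdd hd0 (by linarith [hz₀, hεδ']) hne
  have hz₁ε : |z₁| < ε / 2 := lt_of_le_of_lt hz₁ hz₀
  have hz₁I : z₁ ∈ Ioo (-δ') δ' := ⟨by linarith [(abs_lt.1 hz₁ε).1], by linarith [(abs_lt.1 hz₁ε).2]⟩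
  -- an interval around `z₁` inside `(−ε, ε) ∩ (−δ′, δ′)` where `d′ ≠ 0`
  obtain ⟨ρ₁, hρ₁, hball⟩ : ∃ ρ₁ > 0, ∀ z : ℝ, |z - z₁| < ρ₁ → z ∈ Ioo (-δ') δ' ∧ deriv d z ≠ 0 ∧ |z| < ε := by
    have h1 : ∀ᶠ z in 𝓝 z₁, deriv d z ≠ 0 := (hd'c.continuousAt (hIo.mem_nhds hz₁I)).eventually_ne hd'z₁
    have h2 : ∀ᶠ z in 𝓝 z₁, z ∈ Ioo (-δ') δ' := hIo.mem_nhds hz₁I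
    have h3 : ∀ᶠ z in 𝓝 z₁, |z| < ε := (isOpen_lt continuous_abs continuous_const).mem_nhds (by
      show |z₁| < ε; linarith [abs_nonneg z₁])
    obtain ⟨ρ₁, hρ₁, h⟩ := Metric.eventually_nhds_iff.1 ((h2.and h1).and h3)
    exact ⟨ρ₁, hρ₁, fun z hz => by have := h (by rw [Real.dist_eq]; exact hz); exact ⟨this.1.1, this.1.2, this.2⟩⟩
  -- a non-characteristic sub-window inside it (zeros of `g″` are isolated)
  set ζ : ℝ := min ρ₁ (ε / 2) with hζ
  have hζpos : 0 < ζ := lt_min hρ₁ (by linarith)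
  -- shift: apply the window lemma to `g` around `0` with radius … we need a window around `z₁`; use the translate `z ↦ g (z₁ + z)`? Simpler: the set where `g″ ≠ 0`
  -- is open and dense in `(−δ, δ)`; pick a point of it in `(z₁ − ζ, z₁ + ζ)`.
  have hD2 : AnalyticOnNhd ℝ (deriv (deriv g)) (Ioo (-δ) δ) := hg.deriv.deriv
  have hz₁δ : Ioo (z₁ - ζ) (z₁ + ζ) ⊆ Ioo (-δ) δ := by
    intro z hz
    have h := (hball z (by rw [abs_lt]; constructor <;> linarith [hz.1, hz.2, min_le_left ρ₁ (ε / 2)])).1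
    exact ⟨by linarith [h.1, hδ'δ], by linarith [h.2, hδ'δ]⟩
  have hex : ∃ z₂ ∈ Ioo (z₁ - ζ) (z₁ + ζ), deriv (deriv g) z₂ ≠ 0 := by
    by_contra hall
    push Not at hall
    -- `g″ ≡ 0` on an open interval ⇒ on `(−δ, δ)` ⇒ `g` affine there
    have hev : deriv (deriv g) =ᶠ[𝓝 z₁] 0 :=
      Filter.eventuallyEq_of_mem (isOpen_Ioo.mem_nhds (show z₁ ∈ Ioo (z₁ - ζ) (z₁ + ζ) from ⟨by linarith, by linarith⟩)) fun z hz => hall z hz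
    have hz₁S : z₁ ∈ Ioo (-δ) δ := hz₁δ ⟨by linarith, by linarith⟩
    have hzero := hD2.eqOn_zero_of_preconnected_of_eventuallyEq_zero isPreconnected_Ioo hz₁S hev
    have hδpos : 0 < δ := by linarith [hε, hεδ', hδ'δ]
    have h0S : (0 : ℝ) ∈ Ioo (-δ) δ := ⟨by linarith, hδpos⟩
    have hgd : ∀ z ∈ Ioo (-δ) δ, DifferentiableAt ℝ g z := fun z hz => (hg z hz).differentiableAt
    have hg'd : ∀ z ∈ Ioo (-δ) δ, DifferentiableAt ℝ (deriv g) z := fun z hz => (hg.deriv z hz).differentiableAt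
    have haff := PoloidalWindowDoorLrcModEntireQ4LineTools.affine_of_deriv_deriv_eq_zero isOpen_Ioo isPreconnected_Ioo hgd hg'd (fun z hz => hzero hz) h0S
    exact hns ⟨g 0, deriv g 0, fun z hz => by rw [haff z (abs_lt.1 hz |> fun h => ⟨h.1, h.2⟩)]; ring⟩
  obtain ⟨z₂, hz₂, hg''z₂⟩ := hex
  have hz₂near : |z₂ - z₁| < ρ₁ := by rw [abs_lt]; constructor <;> linarith [hz₂.1, hz₂.2, min_le_left ρ₁ (ε / 2)]
  -- an interval around `z₂` where `g″ ≠ 0`, still inside the `d′ ≠ 0` ball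
  have hg''c : ContinuousAt (deriv (deriv g)) z₂ := (hD2 z₂ (hz₁δ hz₂)).continuousAt
  obtain ⟨ρ₂, hρ₂, hball₂⟩ : ∃ ρ₂ > 0, ∀ z : ℝ, |z - z₂| < ρ₂ → deriv (deriv g) z ≠ 0 ∧ |z - z₁| < ρ₁ := by
    have h1 : ∀ᶠ z in 𝓝 z₂, deriv (deriv g) z ≠ 0 := hg''c.eventually_ne hg''z₂
    have h2 : ∀ᶠ z in 𝓝 z₂, |z - z₁| < ρ₁ := (isOpen_lt (continuous_id.sub continuous_const).abs continuous_const).mem_nhds hz₂near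
    obtain ⟨ρ₂, hρ₂, h⟩ := Metric.eventually_nhds_iff.1 (h1.and h2)
    exact ⟨ρ₂, hρ₂, fun z hz => h (by rw [Real.dist_eq]; exact hz)⟩
  -- on `(z₂ − ρ₂, z₂ + ρ₂)`: `d′ ≠ 0`, `g″ ≠ 0`; `d` is injective there (strictly monotone), so it has at most one zero; drop the half containing it
  have hprop : ∀ z ∈ Ioo (z₂ - ρ₂) (z₂ + ρ₂), z ∈ Ioo (-δ') δ' ∧ deriv d z ≠ 0 ∧ |z| < ε ∧ deriv (deriv g) z ≠ 0 := by
    intro z hz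
    have hzρ₂ : |z - z₂| < ρ₂ := by rw [abs_lt]; constructor <;> linarith [hz.1, hz.2]
    obtain ⟨hg'', hzρ₁⟩ := hball₂ z hzρ₂
    obtain ⟨hI, hd', hzε⟩ := hball z hzρ₁
    exact ⟨hI, hd', hzε, hg''⟩
  have hinj : InjOn d (Ioo (z₂ - ρ₂) (z₂ + ρ₂)) := by
    -- `d′` has no zero on the interval ⇒ `d` takes no value twice (Rolle / mean value theorem)
    have key : ∀ x ∈ Ioo (z₂ - ρ₂) (z₂ + ρ₂), ∀ y ∈ Ioo (z₂ - ρ₂) (z₂ + ρ₂), x < y → d x ≠ d y := by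
      intro x hx y hy hlt hxy
      have hsub : Icc x y ⊆ Ioo (z₂ - ρ₂) (z₂ + ρ₂) := fun z hz => ⟨by linarith [hx.1, hz.1], by linarith [hy.2, hz.2]⟩
      have hcont : ContinuousOn d (Icc x y) := fun z hz => (hdd z (hprop z (hsub hz)).1).continuousAt.continuousWithinAt
      have hdiff : DifferentiableOn ℝ d (Ioo x y) := fun z hz =>
        (hdd z (hprop z (hsub (Ioo_subset_Icc_self hz))).1).differentiableWithinAt
      obtain ⟨c, hc, hcd⟩ := exists_deriv_eq_slope d hlt hcont hdiff
      have h0 : deriv d c = 0 := by rw [hcd, hxy, sub_self, zero_div]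
      exact (hprop c (hsub (Ioo_subset_Icc_self hc))).2.1 h0
    intro x hx y hy hxy
    by_contra hne
    rcases lt_or_gt_of_ne hne with hlt | hlt
    · exact key x hx y hy hlt hxy
    · exact key y hy x hx hlt hxy.symm
  -- choose a half-interval avoiding the (at most one) zero of `d`
  by_cases hzero : ∃ z ∈ Ioo (z₂ - ρ₂) (z₂ + ρ₂), d z = 0
  · obtain ⟨c, hc, hdc⟩ := hzero
    -- take the half above `c` (nonempty since `c < z₂ + ρ₂`)
    refine ⟨c, z₂ + ρ₂, hc.2, fun z hz => ?_, fun z hz => (hprop z ⟨by linarith [hc.1, hz.1], hz.2⟩).2.1, fun z hz => ?_,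
      fun z hz => (hprop z ⟨by linarith [hc.1, hz.1], hz.2⟩).2.2.2⟩
    · have h := (hprop z ⟨by linarith [hc.1, hz.1], hz.2⟩).2.2.1
      exact ⟨(abs_lt.1 h).1, (abs_lt.1 h).2⟩
    · intro hdz
      have hzI : z ∈ Ioo (z₂ - ρ₂) (z₂ + ρ₂) := ⟨by linarith [hc.1, hz.1], hz.2⟩
      have := hinj hzI hc (hdz.trans hdc.symm)
      linarith [hz.1]
  · push Not at hzero
    refine ⟨z₂ - ρ₂, z₂ + ρ₂, by linarith, fun z hz => ?_, fun z hz => (hprop z hz).2.1, fun z hz => hzero z hz, fun z hz => (hprop z hz).2.2.2⟩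
    have h := (hprop z hz).2.2.1
    exact ⟨(abs_lt.1 h).1, (abs_lt.1 h).2⟩

end Summit.NavierStokesRegularity.NavierStokesRegularity.Theorems.PoloidalWindowDoorLrcModEntireCurvedWebWindowSelect

end
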